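import Mathlib
import Summits.ABC.ABC.Theses.RibetTakahashiSplit
import Literature.NumberTheory.Automorphic.ShimuraCurve
import Literature.NumberTheory.EllipticCurves.ModularCurve
import Literature.NumberTheory.EllipticCurves.GlobalMinimalModel
import Literature.NumberTheory.EllipticCurves.Szpiro

/-!
# Sketch — crux idea `waldspurger-localisation` (crux stmt-ABC-15174,
`RibetTakahashiSplit.ManyPrimeValuationProductSemistableFrey`), planner-cruxidea-stmt-ABC-15174-1-0

Statements only (plus one elementary glue theorem, proved).  Vocabulary copied verbatim from the
picked line `Cruxes/ManyPrimeValuationProduct/Lines/jl_zero_cycle_height.lean` (rev a3: the tree's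
`Literature.NumberTheory.Automorphic.ShimuraCurve`), restricted to the SEMISTABLE FREY class of the
re-cut crux.

* `IsCMPointLE S Δ z` — `z ∈ ℍ` is fixed by an elliptic element of `ι(O)` (det `n`, trace `t`,
  `t² < 4n`) of discriminant `4n − t² ≤ Δ`: a CM point of `X_0^D(M)` of (non-fundamental)
  discriminant `≤ Δ`.
* `OrbitLocalisation` — the card's bundled lever on ONE finite sample of CM points of discriminant
  `≤ C N^ε`: (lower) the sample mean of `‖s‖²_pt` is `≥ N^{-ε}/C` — the ARITHMETIC half (Pasten
  Prop 14.2 floor + the deficit `½ log(dD) + log M`); (upper) the sample mean is `≤ C N^ε ×` the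
  global mean — the ANALYTIC half (Waldspurger/YZZ + GLH; convexity gives `N^{1/2}`).
* `meanSquare_of_orbitLocalisation : OrbitLocalisation → MeanSquareLowerBoundSF` — PROVED (sample
  mean squeezed between the two halves); `MeanSquareLowerBoundSF` is the picked line's minimal lever
  `MeanSquareLowerBound` ("JL preserves integral size") on the semistable Frey class, which the landed
  package + covering glue turn into the crux.
* `HeegnerPatternBudget θ` — the Shimura-free arithmetic shadow of "a Heegner field of discriminant
  `≤ C N^{θ+ε}` exists for every sign pattern on the primes of a squarefree `N`" (θ = 1: CRT,
  provable now; θ = 0: GRH-strength; where `2^{ω(N)} ≤ N^{1/log log N}` — prime growth — enters).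
-/

noncomputable section

open MeasureTheory
open scoped MatrixGroups

namespace Summit.ABC.ABC.Cruxes.ManyPrimeValuationProductSemistableFrey.Ideas.WaldspurgerLocalisation

open Literature.NumberTheory.Automorphic
open Literature.NumberTheory.EllipticCurves.ModularForms (IsNeronLatticeOf)
open Literature.NumberTheory.EllipticCurves (freyCurve)
open Summit.ABC.ABC.Theses.RibetTakahashiSplit (ManyPrimeValuationProductSemistableFrey)

/-! ## Arithmetic vocabulary (verbatim from the picked line) -/

/-- Multiplicative primes: `p ∣ N`, `p² ∤ N`. -/
def multPrimes (W : WeierstrassCurve ℚ) : Finset ℕ :=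
  (W.conductorNorm ℤ).primeFactors.filter (fun p => ¬ p ^ 2 ∣ W.conductorNorm ℤ)

/-- `T_D(E) = ∏_{p ∈ D} ord_p Δ_min`. -/
def valProd (W : WeierstrassCurve ℚ) (D : Finset ℕ) : ℕ :=
  ∏ p ∈ D, (W.minimalDiscriminantNorm ℤ).factorization p

/-- Semistable: `p² ∤ N` for every prime (the re-cut crux's class). -/
def IsSemistable (W : WeierstrassCurve ℚ) : Prop :=
  ∀ p : ℕ, p.Prime → ¬ p ^ 2 ∣ W.conductorNorm ℤ

/-- `ℚ`-isomorphic to a twisted Frey–Hellegouarch curve (the crux's second hypothesis, verbatim). -/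
def IsFreyIsomorphic (W : WeierstrassCurve ℚ) : Prop :=
  ∃ (a b d : ℤ) (C' : WeierstrassCurve.VariableChange ℚ), IsCoprime a b ∧ a * b * (a + b) ≠ 0 ∧
    d ∣ 2 ∧ C' • W = freyCurve (d * a) (d * b)

/-- Covering set (admissibility inside): even, `≥ 2` primes, co-level with `≥ 2` multiplicative primes. -/
def IsCoveringSet (W : WeierstrassCurve ℚ) (D : Finset ℕ) : Prop :=
  D ⊆ multPrimes W ∧ Even D.card ∧ 2 ≤ D.card ∧ 2 ≤ (multPrimes W \ D).card

/-- `D' = ∏_{p ∈ D} p`. -/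
def discOf (D : Finset ℕ) : ℕ := ∏ p ∈ D, p

/-- Pointwise Petersson norm `‖s‖²_pt(z) = |s(z)|² (Im z)²`. -/
def pet {Γ : Subgroup (GL (Fin 2) ℝ)} (s : CuspForm Γ 2) (z : UpperHalfPlane) : ℝ :=
  ‖s z‖ ^ 2 * z.im ^ 2

/-- `L` is a Néron period pair of `W`. -/
def IsNeronPeriodPairOf (W : WeierstrassCurve ℚ) (L : PeriodPair) : Prop :=
  ∃ C : WeierstrassCurve.VariableChange ℚ,
    (C • W).IsGloballyMinimal ∧ IsNeronLatticeOf ((C • W).baseChange ℂ) L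

/-! ## CM points of bounded discriminant on `X_0^D(M)` -/

/-- `z` is a CM point of `S` of discriminant `≤ Δ`: some `g = ι(x)`, `x ∈ O`, of determinant `n`
and trace `t` with `t² < 4n` (elliptic) fixes `z`, and `4n − t² ≤ Δ` (`ℤ[x]` is an imaginary
quadratic order of discriminant `t² − 4n`; Heegner points of `K = ℚ(√(t²−4n))` are among these). -/
def IsCMPointLE {D M : ℕ} (S : ShimuraCurveData D M) (Δ : ℝ) (z : UpperHalfPlane) : Prop :=
  ∃ n : ℕ, ∃ g ∈ S.heckeSet n, g • z = z ∧
    (g : Matrix (Fin 2) (Fin 2) ℝ).trace ^ 2 < 4 * (n : ℝ) ∧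
    4 * (n : ℝ) - (g : Matrix (Fin 2) (Fin 2) ℝ).trace ^ 2 ≤ Δ

/-! ## The lever, typed -/

/-- **ORBIT LOCALISATION** (the card's lever, bundled).  For every `ε > 0` there is `C` such that for
every semistable Frey-isomorphic elliptic `W/ℚ`, covering set `D`, Néron period pair `L`, Shimura datum
`S` of level `(∏D, N/∏D)`, fundamental domain `F` of finite positive area and non-zero weight-2 form
`s` with periods in the Néron lattice, there is a finite non-empty sample `Z` of CM points of
discriminant `≤ C N^ε` with
(lower)  `log((#Z)⁻¹ Σ_{z∈Z} ‖s‖²_pt(z)) ≥ −(ε log N + C)` — CM values of the Néron-period form are not small;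
(upper)  `log((#Z)⁻¹ Σ_{z∈Z} ‖s‖²_pt(z)) ≤ ε log N + C + log((vol F)⁻¹ ∫_F ‖s‖²_pt)` — the orbit does not
         over-sample the mass: for a Heegner Galois orbit this is Waldspurger + Lindelöf for
         `L(1/2, f_E × θ_χ)`, `χ` over `Cl(−d)` (convexity gives `½ log N` in place of `ε log N`). -/
def OrbitLocalisation : Prop :=
  ∀ ε : ℝ, 0 < ε → ∃ C : ℝ, ∀ (W : WeierstrassCurve ℚ) [W.IsElliptic],
    IsSemistable W → IsFreyIsomorphic W → ∀ D : Finset ℕ, IsCoveringSet W D →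
    ∀ (L : PeriodPair), IsNeronPeriodPairOf W L →
    ∀ (S : ShimuraCurveData (discOf D) (W.conductorNorm ℤ / discOf D)) (F : Set UpperHalfPlane),
      IsHypFundamentalDomain S.Gamma F → volume F ≠ 0 → volume F ≠ ⊤ →
    ∀ (s : CuspForm S.Gamma 2), s ≠ 0 → HasPeriodsIn S.Gamma s (L.lattice : Set ℂ) →
      IntegrableOn (pet s) F → (0 < ∫ z in F, pet s z) →
      ∃ Z : Finset UpperHalfPlane, Z.Nonempty ∧
        (∀ z ∈ Z, IsCMPointLE S (C * (W.conductorNorm ℤ : ℝ) ^ ε) z) ∧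
        -(ε * Real.log (W.conductorNorm ℤ) + C) ≤ Real.log ((Z.card : ℝ)⁻¹ * ∑ z ∈ Z, pet s z) ∧
        Real.log ((Z.card : ℝ)⁻¹ * ∑ z ∈ Z, pet s z) ≤
          ε * Real.log (W.conductorNorm ℤ) + C + Real.log ((volume F).toReal⁻¹ * ∫ z in F, pet s z)

/-- **ORBIT MEAN-SQUARE LOWER BOUND** (the arithmetic half alone = the card's `C⁺` under GLH):
some finite sample of CM points of discriminant `≤ C N^ε` on which the Néron-period form has mean
square `≥ N^{-ε}/C`.  Pasten Prop 14.2 + Thm 13.2 give the floor `(dD)^{-1} M^{-2}` for every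
non-zero INTEGRAL form at a non-vanishing Heegner orbit of discriminant `d`; the deficit `D M²` is the
open arithmetic core (finite intersection of `Z(s)` with the orbit, level-`M` cokernel at ordinary
CM reductions, AM/GM fluctuation of the conjugates of one algebraic integer). -/
def OrbitMeanSquareLowerBound : Prop :=
  ∀ ε : ℝ, 0 < ε → ∃ C : ℝ, ∀ (W : WeierstrassCurve ℚ) [W.IsElliptic],
    IsSemistable W → IsFreyIsomorphic W → ∀ D : Finset ℕ, IsCoveringSet W D →
    ∀ (L : PeriodPair), IsNeronPeriodPairOf W L →
    ∀ (S : ShimuraCurveData (discOf D) (W.conductorNorm ℤ / discOf D)),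
    ∀ (s : CuspForm S.Gamma 2), s ≠ 0 → HasPeriodsIn S.Gamma s (L.lattice : Set ℂ) →
      ∃ Z : Finset UpperHalfPlane, Z.Nonempty ∧
        (∀ z ∈ Z, IsCMPointLE S (C * (W.conductorNorm ℤ : ℝ) ^ ε) z) ∧
        -(ε * Real.log (W.conductorNorm ℤ) + C) ≤ Real.log ((Z.card : ℝ)⁻¹ * ∑ z ∈ Z, pet s z)

/-- The picked line's MINIMAL LEVER ("JL preserves integral size"), restricted to the semistable Frey
class: `log((vol F)⁻¹ ∫_F ‖s‖²_pt) ≥ −(ε log N + C)`.  Crux-equivalent modulo the two-sided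
Ribet–Takahashi–Pasten package (line rev a1: `pairedFactorisationBound_of_meanSquare`,
`meanSquareLowerBound_of_paired`), then `coveringGlue` (landed). -/
def MeanSquareLowerBoundSF : Prop :=
  ∀ ε : ℝ, 0 < ε → ∃ C : ℝ, ∀ (W : WeierstrassCurve ℚ) [W.IsElliptic],
    IsSemistable W → IsFreyIsomorphic W → ∀ D : Finset ℕ, IsCoveringSet W D →
    ∀ (L : PeriodPair), IsNeronPeriodPairOf W L →
    ∀ (S : ShimuraCurveData (discOf D) (W.conductorNorm ℤ / discOf D)) (F : Set UpperHalfPlane),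
      IsHypFundamentalDomain S.Gamma F → volume F ≠ 0 → volume F ≠ ⊤ →
    ∀ (s : CuspForm S.Gamma 2), s ≠ 0 → HasPeriodsIn S.Gamma s (L.lattice : Set ℂ) →
      IntegrableOn (pet s) F → (0 < ∫ z in F, pet s z) →
        -(ε * Real.log (W.conductorNorm ℤ) + C) ≤
          Real.log ((volume F).toReal⁻¹ * ∫ z in F, pet s z)

/-- **Glue, PROVED.**  Orbit localisation implies the minimal lever: the sample mean is squeezed,
`−(ε log N + C) ≤ log(sample mean) ≤ ε log N + C + log(global mean)`. [folklore] -/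
theorem meanSquare_of_orbitLocalisation (h : OrbitLocalisation) : MeanSquareLowerBoundSF := by
  intro ε hε
  obtain ⟨C, hC⟩ := h (ε / 2) (half_pos hε)
  refine ⟨2 * C, fun W _ hss hfr D hD L hL S F hFD hF0 hFt s hs0 hper hint hI => ?_⟩
  obtain ⟨Z, -, -, hlow, hup⟩ := hC W hss hfr D hD L hL S F hFD hF0 hFt s hs0 hper hint hI
  linarith

/-! ## The Shimura-free arithmetic shadow: Heegner sign patterns are cheap because `2^ω = N^{o(1)}` -/

/-- **HEEGNER PATTERN BUDGET at exponent `θ`.**  For every squarefree `N` and every sign pattern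
`σ` on its odd prime factors there is `0 < d ≤ C N^{θ+ε}` with `(−d / p) = σ(p)` (Jacobi symbol,
non-zero) for every odd `p ∣ N`: a field `ℚ(√−d)` with prescribed splitting at the primes of `N`
(Heegner hypothesis for any `(D, M)`, `D` = the inert primes).  `θ = 1` is CRT (provable now);
`θ = 0` is GRH-strength (least element of a coset of index `2^{ω(N)}`, and `2^{ω(N)} ≤ N^{1/log log N}`
is exactly the prime-growth slack the crux affords); unconditionally Burgess-type `θ = 1/4 + o(1)`
is the expected record.  Used by the line only at `θ = 0` (size half of "small Heegner orbit"). -/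
def HeegnerPatternBudget (θ : ℝ) : Prop :=
  ∀ ε : ℝ, 0 < ε → ∃ C : ℝ, ∀ N : ℕ, Squarefree N → ∀ σ : ℕ → Bool,
    ∃ d : ℕ, 0 < d ∧ (d : ℝ) ≤ C * (N : ℝ) ^ (θ + ε) ∧
      ∀ p ∈ N.primeFactors, p ≠ 2 →
        jacobiSym (-(d : ℤ)) p ≠ 0 ∧ (jacobiSym (-(d : ℤ)) p = 1 ↔ σ p = true)

end Summit.ABC.ABC.Cruxes.ManyPrimeValuationProductSemistableFrey.Ideas.WaldspurgerLocalisation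

end
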